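import Mathlib
import Literature.MathematicalPhysics.QuantumFieldTheory.Balaban1983to89.B12PolarizationHolo

/-!
# `Balaban1983to89.B12PolarizationHoloPairD` — [Balaban1987RG1] (1.20)–(1.22) p. 264 in holomorphic currency, PAIR-LABEL and
# PER-(n, X)-CARRIER form of `B12PolarizationHolo` §2∕§4 (the off-diagonal pair `μ ≠ ν` of (1.22) at every lattice vector, `z = 0`
# included; one normed configuration space `W n X` per finite volume `n` AND per localization domain `X`)

T. Bałaban, *Renormalization group approach to lattice gauge field theories. I*, Commun. Math. Phys. **109** (1987) 249–301
[Balaban1987RG1] («[I]»; PDF page = journal page − 248).  Companion of `…B12PolarizationHolo` (seat `pub-ymgap-dag-n09-a`); written by the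
K0⁷ record definer `ym-nodeO-def-1` (gen 34) on the critic of record's RULING (Φ1)∕(Φ2) (cell `ym-nodeO-ideate` STATUS 2026-08-30T23:48:07Z,
port ledger Q-6) for port unit PT-H.  NOTHING landed is modified and §1∕§3 of `…B12PolarizationHolo` (`differentiableOn_mixedDeriv`,
`analyticOnNhd_section`, `exists_holo_limit`) are USED BY NAME; only §2 (one finite volume) and §4 (assembly) are re-issued, with two changes:

* (Φ1) PAIR LABELS.  `…B12PolarizationHolo.exists_holo_kernel` evaluates ONE window map at `0` and at `z` — `piT … g (e n 0) (e n z)` — so at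
  `z = 0` both slots carry the same response vector and the kernel it produces is, at the origin, a DIAGONAL second derivative.  Print's (1.22)
  p. 264 reads, verbatim, *«β_{j+1}(g_j) = … = Σ_x Π_{j+1,μν}(g_j, x) x_μ x_ν for μ, ν arbitrary, μ ≠ ν»*: the kernel is the OFF-DIAGONAL
  component `Π_{μν}(0, z) = ∂²𝐄∕∂B_μ(0)∂B_ν(z)` ((1.20)), whose two slots carry DIFFERENT directions also at `z = 0`; and `PiHoloSource.re_eq` ∕
  `hPk` quantify over every `z`.  Here: TWO window maps, the origin label `e₀ n : Λn n` (direction `μ` at `0`) and the running label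
  `e n : ℤ^d → Λn n` (direction `ν` at `z`).
* (Φ2) PER-(n, X) CARRIERS.  The (4.4) analyticity domain *«max{∣𝐀∣_X, ∣∇^ξ𝐀∣_X, ∣Δ^ξ𝐀∣_X} < α₂»* (p. 281) is a ball in a norm that
  depends on the localization domain `X` (the porters' GAUGE currency: cut coordinates normed by the Minkowski gauge of the (4.4) domain, so that
  the letters `α₂, B₃` are LEVEL-FREE and `β′` is uniform — the critic's instance requirement).  `…B12PolarizationHolo` §2 has ONE carrier `W` per
  volume; the engine `B12Decay510.abs_twoPoint_le_of_repr435` is already per-`X` (`V : S.Dom → Type*`).  Here: `W : S.Dom → Type*`,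
  `EX : ℂ → (X : S.Dom) → W X → ℂ`, `h : (X : S.Dom) → Λ → W X`, and in the assembly `Wn : (n : ℕ) → (Sn n).Dom → Type*`.

Contents: `piTD` ((4.37) at a complex coupling, per-X carriers), `re_piTD`, `differentiableOn_piTD`, `norm_piTD_le` ((5.10) at one coupling);
`exists_holo_kernel_pairD`, `nonempty_piHoloSource_of_analytic_leaves_pairD`, `betaClauses_of_analytic_leaves_pairD`.  The one-map ∕ one-carrier
theorems of `…B12PolarizationHolo` are the special case `W := fun _ => W₀`, `e₀ n := e n 0`.

HONEST FRAMING.  Count-neutral Literature bookkeeping (a re-assembly of landed lemmas over a wider carrier signature); nothing of [I] is asserted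
beyond what `…B12PolarizationHolo` already derives from its displayed hypotheses; the SIGN of β (NODE O) untouched; one finite four-torus programme
at fixed ε — NOT ℝ⁴, NOT infinite volume, NOT OS axioms, NOT a mass gap, NOT the Clay problem.  No `sorry`, no `instance`, no `notation`.
-/

noncomputable section

open Set Filter Metric Topology Complex

namespace Literature.MathematicalPhysics.QuantumFieldTheory.Balaban1983to89.B12PolarizationHoloPairD

open Literature.MathematicalPhysics.QuantumFieldTheory.Balaban1983to89
open Literature.MathematicalPhysics.QuantumFieldTheory.Balaban1983to89.Step
open Literature.MathematicalPhysics.QuantumFieldTheory.Balaban1983to89.B12StepObligation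
open Literature.MathematicalPhysics.QuantumFieldTheory.Balaban1983to89.B12BetaSmooth
open Literature.MathematicalPhysics.QuantumFieldTheory.Balaban1983to89.B12BetaHolo
open Literature.MathematicalPhysics.QuantumFieldTheory.Balaban1983to89.B12PolarizationHolo

/-! ## §2D. One finite volume, per-X carriers: the complex kernel (4.37) at complex couplings — holomorphy and (5.10) -/

section FiniteVolumeD

variable {S : LocDomainSys} {C : B12.CubeCover S} {Λ : Type*} {W : S.Dom → Type*}
  [∀ X, NormedAddCommGroup (W X)] [∀ X, NormedSpace ℂ (W X)] {U : Set ℂ}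

/-- **(4.37)∕(1.20) at a complex coupling, PER-X CARRIERS**: `Π_T(g; x, y) = Σ_X ∂²/∂τ₁∂τ₂ 𝐄(X, g, τ₁h_X(x) + τ₂h_X(y))∣₀` with the
configuration `𝐀 ∈ W X` living in the localization domain's OWN normed space ((4.4) p.281 is a per-X condition).
[cite: Balaban1987RG1, (4.37) p.291 with (4.35) p.290, (1.20) p.264, (4.4) p.281] -/
def piTD (EX : ℂ → (X : S.Dom) → W X → ℂ) (h : (X : S.Dom) → Λ → W X) (g : ℂ) (x y : Λ) : ℂ :=
  ∑ X, B12Decay510.mixedDeriv (EX g X) (h X x) (h X y)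

/-- At a real coupling the real kernel (real parts termwise) is the real part of `Π_T`. [cite: Balaban1987RG1, (4.37) p.291] -/
theorem re_piTD (EX : ℂ → (X : S.Dom) → W X → ℂ) (h : (X : S.Dom) → Λ → W X) (g : ℂ) (x y : Λ) :
    (piTD EX h g x y).re = ∑ X, (B12Decay510.mixedDeriv (EX g X) (h X x) (h X y)).re := by
  simp [piTD, Complex.re_sum]

/-- **`Π_T(·; x, y)` is holomorphic on `U`** when every term `(g, 𝐀) ↦ 𝐄(X, g, 𝐀)` is jointly analytic on `U × {‖𝐀‖_X < α₂}` (finite sum of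
`B12PolarizationHolo.differentiableOn_mixedDeriv`, one carrier per `X`). [cite: Balaban1987RG1, p.266 (analytic alternative) with (4.37) p.291] -/
theorem differentiableOn_piTD (hU : IsOpen U) {α₂ : ℝ} (hα₂ : 0 < α₂) (EX : ℂ → (X : S.Dom) → W X → ℂ)
    (h : (X : S.Dom) → Λ → W X) (han : ∀ X, AnalyticOnNhd ℂ (fun p : ℂ × W X => EX p.1 X p.2) (U ×ˢ ball 0 α₂))
    (x y : Λ) : DifferentiableOn ℂ (fun g => piTD EX h g x y) U :=
  DifferentiableOn.fun_sum fun X _ => differentiableOn_mixedDeriv hU hα₂ (fun g => EX g X) (han X) _ _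

/-- **(5.10) for `Π_T` at one (complex) coupling, PER-X CARRIERS**, with the constants of `B12Decay510`: sections analytic on `{‖𝐀‖_X < α₂}` with
(1.18) there, responses with the p.282 decay IN THE X-NORM, and the geometry ∕ cube-sum ∕ domain-sum leaves give
`‖Π_T(g; x, y)‖ ≤ 4E₀α₂⁻² B₃² e^{δ₁Mc₁} K₀K₁ e^{−δ₁ρ(x,y)}`, `δ₁ = ½ min{δ₀, κM⁻¹}` (the engine `B12Decay510.abs_twoPoint_le_of_repr435` at `V := W`).
[cite: Balaban1987RG1, (5.10) p.293] -/
theorem norm_piTD_le (G : B12Decay510.SiteGeometry C Λ) {ρ : Λ → Λ → ℝ} (EX : ℂ → (X : S.Dom) → W X → ℂ)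
    (h : (X : S.Dom) → Λ → W X) {α₂ E₀ B₃ κ δ₀ M c₁ K₀ K₁ : ℝ} (hα₂ : 0 < α₂) (hE₀ : 0 ≤ E₀) (hB₃ : 0 ≤ B₃)
    (hK₀ : 0 ≤ K₀) (hδ₀ : 0 ≤ δ₀) (hκ : 0 ≤ κ) (hM : 0 < M) {g : ℂ}
    (han : ∀ X, AnalyticOnNhd ℂ (EX g X) (ball 0 α₂))
    (h118 : ∀ X, ∀ v ∈ ball (0 : W X) α₂, ‖EX g X v‖ ≤ E₀ * Real.exp (-κ * S.dj X))
    (hh : ∀ X x, ‖h X x‖ ≤ B₃ * Real.exp (-δ₀ * G.distD x X))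
    (hgeo : B12Decay510.GeomLeaf G ρ M c₁) (hcube : B12Decay510.CubeSumLeaf G (δ₀ / 2) K₁)
    (htree : B12Decay510.TreeLeaf C (κ / 2) K₀) (x y : Λ) :
    ‖piTD EX h g x y‖ ≤ 4 * E₀ / α₂ ^ 2 * B₃ ^ 2 * Real.exp (B12Decay510.delta1 δ₀ κ M * M * c₁) * K₀ * K₁ *
      Real.exp (-(B12Decay510.delta1 δ₀ κ M) * ρ x y) := by
  have hQ : ∀ X (a b : W X), |‖B12Decay510.mixedDeriv (EX g X) a b‖| ≤
      4 * E₀ / α₂ ^ 2 * Real.exp (-κ * S.dj X) * ‖a‖ * ‖b‖ := fun X a b => by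
    rw [abs_norm]
    calc ‖B12Decay510.mixedDeriv (EX g X) a b‖
        ≤ 4 * (E₀ * Real.exp (-κ * S.dj X)) / α₂ ^ 2 * ‖a‖ * ‖b‖ :=
          B12Decay510.norm_mixedDeriv_le hα₂ (han X) (h118 X) a b
      _ = 4 * E₀ / α₂ ^ 2 * Real.exp (-κ * S.dj X) * ‖a‖ * ‖b‖ := by ring
  have hb := B12Decay510.abs_twoPoint_le_of_repr435 G (ρ := ρ) (V := W)
    (fun X a b => ‖B12Decay510.mixedDeriv (EX g X) a b‖) h
    (fun X x' y' => ‖B12Decay510.mixedDeriv (EX g X) (h X x') (h X y')‖) (A := 4 * E₀ / α₂ ^ 2) (by positivity)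
    hB₃ hK₀ hδ₀ hκ hM (fun _ _ _ => rfl) hQ hh hgeo hcube htree x y
  calc ‖piTD EX h g x y‖ ≤ ∑ X, ‖B12Decay510.mixedDeriv (EX g X) (h X x) (h X y)‖ := norm_sum_le _ _
    _ ≤ |∑ X, ‖B12Decay510.mixedDeriv (EX g X) (h X x) (h X y)‖| := le_abs_self _
    _ ≤ _ := hb

end FiniteVolumeD

/-! ## §4D. Assembly, PAIR LABELS and PER-(n, X) CARRIERS: a holomorphic Π-source from the analytic-in-the-coupling leaves -/

section AssemblyD

variable {U : Set ℂ} {d : ℕ}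

/-- **(1.20)–(1.21) IN HOLOMORPHIC CURRENCY, END TO END — PAIR LABELS, PER-(n, X) CARRIERS.**  A sequence `n` of finite systems (the tori
`T^{(k+1)}`), on each: per-domain configuration spaces `Wn n X`, terms `(g, 𝐀) ↦ 𝐄ₙ(X, g, 𝐀)` jointly analytic on `U × {‖𝐀‖_{n,X} < α₂}` (`U ⊆ ℂ`
connected open, `⊇ [0, γ]`, `γ > 0`) obeying (1.18) there uniformly in `g ∈ U`, responses `hₙ X` with the p.282 decay in the `(n, X)`-norm, the leaves
`GeomLeaf`∕`CubeSumLeaf`∕`TreeLeaf` with volume-uniform constants, an ORIGIN label `e₀ n` and RUNNING labels `e n z` eventually at label distance `|z|₁`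
(`hρ`), and convergence of `Π_{Tₙ}(t; e₀ n, e n z)` at every REAL `t ∈ [0, γ]` to the printed limit `Pℓ t z` ((1.21)).  THEN there is
`Pc : ℂ → ℤ^d → ℂ` with every `g ↦ Pc(g, z)` HOLOMORPHIC on `U`, (5.10) ON `U` — `‖Pc(g, z)‖ ≤ 4E₀α₂⁻²B₃² e^{δ₁Mc₁}K₀K₁ · e^{−δ₁|z|₁}`,
`δ₁ = ½ min{δ₀, κM⁻¹}` — `Pc(t, z) = Pℓ t z` on `[0, γ]`, and `Π_{Tₙ}(g; e₀ n, e n z) → Pc(g, z)` for every `g ∈ U`.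
[cite: Balaban1987RG1, (1.20)–(1.22) p.264 with p.266 and (5.10) p.293] -/
theorem exists_holo_kernel_pairD (hU : IsOpen U) (hUc : IsPreconnected U) {γ : ℝ} (hγ : 0 < γ)
    (hIU : ∀ t ∈ Icc (0 : ℝ) γ, (t : ℂ) ∈ U)
    (Sn : ℕ → LocDomainSys) (Cn : (n : ℕ) → B12.CubeCover (Sn n)) (Λn : ℕ → Type*)
    (Gn : (n : ℕ) → B12Decay510.SiteGeometry (Cn n) (Λn n)) (ρn : (n : ℕ) → Λn n → Λn n → ℝ)
    (Wn : (n : ℕ) → (Sn n).Dom → Type*) [∀ n X, NormedAddCommGroup (Wn n X)] [∀ n X, NormedSpace ℂ (Wn n X)]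
    (EXn : (n : ℕ) → ℂ → (X : (Sn n).Dom) → Wn n X → ℂ) (hn : (n : ℕ) → (X : (Sn n).Dom) → Λn n → Wn n X)
    (e₀ : (n : ℕ) → Λn n) (e : (n : ℕ) → (Fin d → ℤ) → Λn n) (Pℓ : ℝ → (Fin d → ℤ) → ℂ)
    {α₂ E₀ B₃ κ δ₀ M c₁ K₀ K₁ : ℝ} (hα₂ : 0 < α₂) (hE₀ : 0 ≤ E₀) (hB₃ : 0 ≤ B₃) (hK₀ : 0 ≤ K₀) (hδ₀ : 0 ≤ δ₀)
    (hκ : 0 ≤ κ) (hM : 0 < M)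
    (han : ∀ n X, AnalyticOnNhd ℂ (fun p : ℂ × Wn n X => EXn n p.1 X p.2) (U ×ˢ ball 0 α₂))
    (h118 : ∀ n, ∀ g ∈ U, ∀ X, ∀ v ∈ ball (0 : Wn n X) α₂, ‖EXn n g X v‖ ≤ E₀ * Real.exp (-κ * (Sn n).dj X))
    (hh : ∀ n X x, ‖hn n X x‖ ≤ B₃ * Real.exp (-δ₀ * (Gn n).distD x X))
    (hgeo : ∀ n, B12Decay510.GeomLeaf (Gn n) (ρn n) M c₁) (hcube : ∀ n, B12Decay510.CubeSumLeaf (Gn n) (δ₀ / 2) K₁)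
    (htree : ∀ n, B12Decay510.TreeLeaf (Cn n) (κ / 2) K₀)
    (hρ : ∀ z, ∀ᶠ n in atTop, ρn n (e₀ n) (e n z) = B12Sec2to5.l1 z)
    (hlim : ∀ z, ∀ t ∈ Icc (0 : ℝ) γ, Tendsto (fun n => piTD (EXn n) (hn n) t (e₀ n) (e n z)) atTop (𝓝 (Pℓ t z))) :
    ∃ Pc : ℂ → (Fin d → ℤ) → ℂ, (∀ z, DifferentiableOn ℂ (fun g => Pc g z) U) ∧
      (∀ z, ∀ g ∈ U, ‖Pc g z‖ ≤ 4 * E₀ / α₂ ^ 2 * B₃ ^ 2 * Real.exp (B12Decay510.delta1 δ₀ κ M * M * c₁) * K₀ * K₁ *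
        Real.exp (-(B12Decay510.delta1 δ₀ κ M) * B12Sec2to5.l1 z)) ∧
      (∀ z, ∀ t ∈ Icc (0 : ℝ) γ, Pc t z = Pℓ t z) ∧
      (∀ z, ∀ g ∈ U, Tendsto (fun n => piTD (EXn n) (hn n) g (e₀ n) (e n z)) atTop (𝓝 (Pc g z))) := by
  set Kc : ℝ := 4 * E₀ / α₂ ^ 2 * B₃ ^ 2 * Real.exp (B12Decay510.delta1 δ₀ κ M * M * c₁) * K₀ * K₁ with hKc
  -- per lattice point: Vitali (`B12PolarizationHolo.exists_holo_limit`)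
  have key : ∀ z : Fin d → ℤ, ∃ f : ℂ → ℂ, DifferentiableOn ℂ f U ∧
      (∀ g ∈ U, Tendsto (fun n => piTD (EXn n) (hn n) g (e₀ n) (e n z)) atTop (𝓝 (f g))) ∧
      (∀ g ∈ U, ‖f g‖ ≤ Kc * Real.exp (-(B12Decay510.delta1 δ₀ κ M) * B12Sec2to5.l1 z)) ∧
      (∀ t ∈ Icc (0 : ℝ) γ, f t = Pℓ t z) := by
    intro z
    refine exists_holo_limit hU hUc hγ hIU (fun n g => piTD (EXn n) (hn n) g (e₀ n) (e n z))
      (fun n => differentiableOn_piTD hU hα₂ (EXn n) (hn n) (han n) _ _) ?_ (fun t => Pℓ t z) (hlim z)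
    filter_upwards [hρ z] with n hn' g hg
    have hb := norm_piTD_le (Gn n) (ρ := ρn n) (EXn n) (hn n) hα₂ hE₀ hB₃ hK₀ hδ₀ hκ hM (g := g)
      (fun X => analyticOnNhd_section (fun g' => EXn n g' X) (han n X) hg) (h118 n g hg) (hh n) (hgeo n)
      (hcube n) (htree n) (e₀ n) (e n z)
    rw [hn'] at hb
    exact hb
  choose f hf hconv hbd hreal using key
  exact ⟨fun g z => f z g, fun z => hf z, fun z => hbd z, fun z => hreal z, fun z => hconv z⟩

variable {P : Params} {G : Type*} [GaugeGroup G] {Φ 𝒢 : Type*}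

/-- **`Nonempty (B12BetaHolo.PiHoloSource T c k)` FROM THE ANALYTIC-IN-THE-COUPLING LEAVES — PAIR LABELS, PER-(n, X) CARRIERS**: under the leaves of
`exists_holo_kernel_pairD` with `U ⊇ [0, c.γ]`, `δ₀, κ > 0`, a tower whose `β_{k+1}` is (5.42) of a real kernel family `Pk` whose OFF-DIAGONAL
`(μ, ν)`-component is the REAL PART of the printed limit `Pℓ` at real couplings, and `β′ ≥ betaPrime510 d C δ₁` for the explicit
`C = 4E₀α₂⁻²B₃² e^{δ₁Mc₁}K₀K₁`, `δ₁ = ½ min{δ₀, κM⁻¹}`.  No g-derivative of any `E^{(j)}` is assumed.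
[cite: Balaban1987RG1, (1.20)–(1.22) p.264, p.266 (analytic alternative), (5.10) p.293, (5.42) p.297] -/
theorem nonempty_piHoloSource_of_analytic_leaves_pairD {T : SFTower P G Φ 𝒢} {c : SFConsts} {k : ℕ}
    (hU : IsOpen U) (hUc : IsPreconnected U) (hγ : 0 < c.γ) (hIU : ∀ t ∈ Icc (0 : ℝ) c.γ, (t : ℂ) ∈ U)
    (Sn : ℕ → LocDomainSys) (Cn : (n : ℕ) → B12.CubeCover (Sn n)) (Λn : ℕ → Type*)
    (Gn : (n : ℕ) → B12Decay510.SiteGeometry (Cn n) (Λn n)) (ρn : (n : ℕ) → Λn n → Λn n → ℝ)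
    (Wn : (n : ℕ) → (Sn n).Dom → Type*) [∀ n X, NormedAddCommGroup (Wn n X)] [∀ n X, NormedSpace ℂ (Wn n X)]
    (EXn : (n : ℕ) → ℂ → (X : (Sn n).Dom) → Wn n X → ℂ) (hn : (n : ℕ) → (X : (Sn n).Dom) → Λn n → Wn n X)
    (e₀ : (n : ℕ) → Λn n) (e : (n : ℕ) → (Fin d → ℤ) → Λn n) (Pℓ : ℝ → (Fin d → ℤ) → ℂ) (μ ν : Fin d)
    (Pk : ℝ → B12Beta.Kernel d)
    (beta_eq : ∀ g, 0 ≤ g → g ≤ c.γ → T.flow.β (k + 1) g = B12Beta.secondMoment (Pk g) μ ν)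
    (hPk : ∀ z, ∀ t ∈ Icc (0 : ℝ) c.γ, Pk t μ ν z = (Pℓ t z).re)
    {α₂ E₀ B₃ κ δ₀ M c₁ K₀ K₁ : ℝ} (hα₂ : 0 < α₂) (hE₀ : 0 ≤ E₀) (hB₃ : 0 ≤ B₃) (hK₀ : 0 ≤ K₀) (hδ₀ : 0 < δ₀)
    (hκ : 0 < κ) (hM : 0 < M)
    (le_beta' : B12Sec2to5.betaPrime510 d
      (4 * E₀ / α₂ ^ 2 * B₃ ^ 2 * Real.exp (B12Decay510.delta1 δ₀ κ M * M * c₁) * K₀ * K₁)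
      (B12Decay510.delta1 δ₀ κ M) ≤ c.β')
    (han : ∀ n X, AnalyticOnNhd ℂ (fun p : ℂ × Wn n X => EXn n p.1 X p.2) (U ×ˢ ball 0 α₂))
    (h118 : ∀ n, ∀ g ∈ U, ∀ X, ∀ v ∈ ball (0 : Wn n X) α₂, ‖EXn n g X v‖ ≤ E₀ * Real.exp (-κ * (Sn n).dj X))
    (hh : ∀ n X x, ‖hn n X x‖ ≤ B₃ * Real.exp (-δ₀ * (Gn n).distD x X))
    (hgeo : ∀ n, B12Decay510.GeomLeaf (Gn n) (ρn n) M c₁) (hcube : ∀ n, B12Decay510.CubeSumLeaf (Gn n) (δ₀ / 2) K₁)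
    (htree : ∀ n, B12Decay510.TreeLeaf (Cn n) (κ / 2) K₀)
    (hρ : ∀ z, ∀ᶠ n in atTop, ρn n (e₀ n) (e n z) = B12Sec2to5.l1 z)
    (hlim : ∀ z, ∀ t ∈ Icc (0 : ℝ) c.γ,
      Tendsto (fun n => piTD (EXn n) (hn n) t (e₀ n) (e n z)) atTop (𝓝 (Pℓ t z))) :
    Nonempty (PiHoloSource T c k) := by
  obtain ⟨Pc, hPc, hbd, hreal, -⟩ := exists_holo_kernel_pairD hU hUc hγ hIU Sn Cn Λn Gn ρn Wn EXn hn e₀ e Pℓ hα₂ hE₀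
    hB₃ hK₀ hδ₀.le hκ.le hM han h118 hh hgeo hcube htree hρ hlim
  exact nonempty_piHoloSource μ ν Pk beta_eq hU hIU Pc hPc (B12Decay510.delta1_pos hδ₀ hκ hM) hbd
    (fun z t ht => by rw [hPk z t ht, hreal z t ht]) le_beta'

/-- **The β-clauses of the Theorem-3 step FROM THE ANALYTIC-IN-THE-COUPLING LEAVES — PAIR LABELS, PER-(n, X) CARRIERS** (composition with
`B12BetaHolo.betaClauses_of_piHolo`): `BetaSmoothAt`, `BetaAnalyticAt`, `|β_{k+1}| ≤ β′` on `[0, γ]`, and all-derivative bounds.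
[cite: Balaban1987RG1, p.264 (β-clause) with p.266 (analytic alternative)] -/
theorem betaClauses_of_analytic_leaves_pairD {T : SFTower P G Φ 𝒢} {c : SFConsts} {k : ℕ}
    (hU : IsOpen U) (hUc : IsPreconnected U) (hγ : 0 < c.γ) (hIU : ∀ t ∈ Icc (0 : ℝ) c.γ, (t : ℂ) ∈ U)
    (Sn : ℕ → LocDomainSys) (Cn : (n : ℕ) → B12.CubeCover (Sn n)) (Λn : ℕ → Type*)
    (Gn : (n : ℕ) → B12Decay510.SiteGeometry (Cn n) (Λn n)) (ρn : (n : ℕ) → Λn n → Λn n → ℝ)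
    (Wn : (n : ℕ) → (Sn n).Dom → Type*) [∀ n X, NormedAddCommGroup (Wn n X)] [∀ n X, NormedSpace ℂ (Wn n X)]
    (EXn : (n : ℕ) → ℂ → (X : (Sn n).Dom) → Wn n X → ℂ) (hn : (n : ℕ) → (X : (Sn n).Dom) → Λn n → Wn n X)
    (e₀ : (n : ℕ) → Λn n) (e : (n : ℕ) → (Fin d → ℤ) → Λn n) (Pℓ : ℝ → (Fin d → ℤ) → ℂ) (μ ν : Fin d)
    (Pk : ℝ → B12Beta.Kernel d)
    (beta_eq : ∀ g, 0 ≤ g → g ≤ c.γ → T.flow.β (k + 1) g = B12Beta.secondMoment (Pk g) μ ν)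
    (hPk : ∀ z, ∀ t ∈ Icc (0 : ℝ) c.γ, Pk t μ ν z = (Pℓ t z).re)
    {α₂ E₀ B₃ κ δ₀ M c₁ K₀ K₁ : ℝ} (hα₂ : 0 < α₂) (hE₀ : 0 ≤ E₀) (hB₃ : 0 ≤ B₃) (hK₀ : 0 ≤ K₀) (hδ₀ : 0 < δ₀)
    (hκ : 0 < κ) (hM : 0 < M)
    (le_beta' : B12Sec2to5.betaPrime510 d
      (4 * E₀ / α₂ ^ 2 * B₃ ^ 2 * Real.exp (B12Decay510.delta1 δ₀ κ M * M * c₁) * K₀ * K₁)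
      (B12Decay510.delta1 δ₀ κ M) ≤ c.β')
    (han : ∀ n X, AnalyticOnNhd ℂ (fun p : ℂ × Wn n X => EXn n p.1 X p.2) (U ×ˢ ball 0 α₂))
    (h118 : ∀ n, ∀ g ∈ U, ∀ X, ∀ v ∈ ball (0 : Wn n X) α₂, ‖EXn n g X v‖ ≤ E₀ * Real.exp (-κ * (Sn n).dj X))
    (hh : ∀ n X x, ‖hn n X x‖ ≤ B₃ * Real.exp (-δ₀ * (Gn n).distD x X))
    (hgeo : ∀ n, B12Decay510.GeomLeaf (Gn n) (ρn n) M c₁) (hcube : ∀ n, B12Decay510.CubeSumLeaf (Gn n) (δ₀ / 2) K₁)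
    (htree : ∀ n, B12Decay510.TreeLeaf (Cn n) (κ / 2) K₀)
    (hρ : ∀ z, ∀ᶠ n in atTop, ρn n (e₀ n) (e n z) = B12Sec2to5.l1 z)
    (hlim : ∀ z, ∀ t ∈ Icc (0 : ℝ) c.γ,
      Tendsto (fun n => piTD (EXn n) (hn n) t (e₀ n) (e n z)) atTop (𝓝 (Pℓ t z))) :
    BetaSmoothAt T c k ∧ BetaAnalyticAt T c k ∧ (∀ x ∈ Set.Icc (0 : ℝ) c.γ, |T.flow.β (k + 1) x| ≤ c.β') ∧
      ∃ β'n : ℕ → ℝ, BetaDerivBoundsAt T c k β'n := by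
  obtain ⟨S⟩ := nonempty_piHoloSource_of_analytic_leaves_pairD hU hUc hγ hIU Sn Cn Λn Gn ρn Wn EXn hn e₀ e Pℓ μ ν Pk
    beta_eq hPk hα₂ hE₀ hB₃ hK₀ hδ₀ hκ hM le_beta' han h118 hh hgeo hcube htree hρ hlim
  obtain ⟨h1, h2, h3, h4⟩ := betaClauses_of_piHolo hγ S
  exact ⟨h1, h2, h3, _, h4⟩

end AssemblyD

end Literature.MathematicalPhysics.QuantumFieldTheory.Balaban1983to89.B12PolarizationHoloPairD

end
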